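import Summits.QuantumFields.GaugeBoot.Certificates.SparseReducedWindowBound
import HarnessLib

/-!
# Sparse certificate replay, part 5c: EARLY-EXIT window sweep (sorted entries, shifted keys, lean trie, raw dot product)

HONEST FRAMING (cell `pub-gaugeboot`): certified bounds on lattice expectations at stated coupling,
gauge group, dimension and torus size; NOT a mass gap, NOT a continuum limit, NOT a string tension;
NOT Yang–Mills-summit-bearing (barriers `FixedCouplingUltralocality`, `PerturbativeInvisibility`).

Generic support for the cell-side emitter `gb_lean_emit_win` ≥ 0.10.  The window route of parts 5/5b
(`SparseReducedWindow(Bound).lean`: `winCheck` → `WinOK`) spends, per certificate of the family `KZL2rpD4`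
(10 878 variables, 469 995 stored terms, 18 windows), ≈ 1 050 s of kernel time: ≈ 520 s trie inserts (14 levels each),
≈ 290 s walking ALL stored terms once per window, ≈ 140 s Gram dot products through the equation-compiled `listDot`
(farm measurements 2026-08-22, lean3 gen 7).  This part adds a kernel-side twin `winCheckE` that establishes the SAME
window statement `WinOK` (so the per-certificate assembly `WinOK.append` / `objective_bound_win` is unchanged) and is
cheaper in three independent ways, all `[folklore]`:

* EARLY EXIT: every stored entry lists its terms `(v, c)` with STRICTLY INCREASING `v` (family-level check
  `sortedCheck`, one `decide` per family); the window walk skips the terms `v < lo`, inserts while `v < hi` and stops at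
  the first `v ≥ hi` (`accTermsE`) — on average half of the term visits;
* SHIFTED KEYS: the trie key is `v − lo` at depth `d` with `hi − lo ≤ 2^d` (10–12 levels instead of 14), lean insert
  `Trie.addL` (node scrutinised first, parity by `Nat.casesOn`, no projection thunks);
* RAW DOT PRODUCT `listDotR` (`List.rec`, explicit `Int.mul` / `Int.add`) = `listDot`.

Semantics are TRANSFERRED, not re-proved: under `sortedCheck EB`, `sweepE GB EB nb m d lo hi` EQUALS the part-5 sweep
`sweepR` run on the shifted-and-filtered table `EBshift lo hi EB` over the window `0 ≤ v' < hi − lo` (`sweepE_eq`), whose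
trace values are those of `EB` at `lo + v'` (`trZ_shift`); hence `winOK_of_checkE : winCheckE … = true → WinOK …`.
Nothing here is specific to lattice gauge theory.
-/

namespace Summit.QuantumFields.GaugeBoot.Certificates.Sparse

open Matrix Finset Literature.Computation.Certificates

noncomputable section

/-! ## Raw dot product -/

/-- Dot product of two integer lists via the raw recursor (explicit `Int.mul` / `Int.add`). [folklore] -/
def listDotR : List ℤ → List ℤ → ℤ :=
  @List.rec ℤ (fun _ => List ℤ → ℤ) (fun _ => 0)
    (fun a _ ih bs => @List.casesOn ℤ (fun _ => ℤ) bs 0 (fun b bs' => Int.add (Int.mul a b) (ih bs')))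

/-- `listDotR = listDot`. [folklore] -/
theorem listDotR_eq : ∀ a b : List ℤ, listDotR a b = listDot a b
  | [], b => by cases b <;> rfl
  | _ :: _, [] => by simp [listDotR]
  | a :: as, b :: bs => by
    rw [listDot_cons_cons, ← listDotR_eq as bs]; rfl

/-! ## Lean trie insert -/

namespace Trie

/-- LEAN insert (kernel-side twin of `add`): scrutinise the node first, branch on the parity of the key by
`Nat.casesOn (w % 2)`, recurse on the depth by the raw recursor. [folklore] -/
def addL (d : ℕ) : Trie → ℕ → ℤ → Trie :=
  @Nat.rec (fun _ => Trie → ℕ → ℤ → Trie)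
    (fun t _ c => @Trie.casesOn (fun _ => Trie) t (leaf c) (fun z => leaf (Int.add z c)) (fun _ _ => leaf c))
    (fun _ ih t w c => @Trie.casesOn (fun _ => Trie) t
      (@Nat.casesOn (fun _ => Trie) (Nat.mod w 2) (node (ih nil (Nat.div w 2) c) nil)
        (fun _ => node nil (ih nil (Nat.div w 2) c)))
      (fun _ => @Nat.casesOn (fun _ => Trie) (Nat.mod w 2) (node (ih nil (Nat.div w 2) c) nil)
        (fun _ => node nil (ih nil (Nat.div w 2) c)))
      (fun l r => @Nat.casesOn (fun _ => Trie) (Nat.mod w 2) (node (ih l (Nat.div w 2) c) r)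
        (fun _ => node l (ih r (Nat.div w 2) c)))) d

/-- The parity dispatch used by `addL`, as an `if`. [folklore] -/
private theorem natCasesOn_mod_two {α : Sort _} (w : ℕ) (A : α) (B : ℕ → α) :
    @Nat.casesOn (fun _ => α) (Nat.mod w 2) A B = if w % 2 = 0 then A else B 0 := by
  rcases Nat.mod_two_eq_zero_or_one w with h | h
  · rw [if_pos h, show Nat.mod w 2 = 0 from h]; rfl
  · rw [if_neg (by omega), show Nat.mod w 2 = 1 from h]; rfl

/-- `addL = add`. [folklore] -/
theorem addL_eq : ∀ (d : ℕ) (t : Trie) (w : ℕ) (c : ℤ), addL d t w c = add d t w c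
  | 0, nil, _, _ => rfl
  | 0, leaf _, _, _ => rfl
  | 0, node _ _, _, _ => rfl
  | d + 1, t, w, c => by
    have step : ∀ l r : Trie, addL (d + 1) (t) w c =
        @Trie.casesOn (fun _ => Trie) t
          (@Nat.casesOn (fun _ => Trie) (Nat.mod w 2) (node (addL d nil (Nat.div w 2) c) nil)
            (fun _ => node nil (addL d nil (Nat.div w 2) c)))
          (fun _ => @Nat.casesOn (fun _ => Trie) (Nat.mod w 2) (node (addL d nil (Nat.div w 2) c) nil)
            (fun _ => node nil (addL d nil (Nat.div w 2) c)))
          (fun l r => @Nat.casesOn (fun _ => Trie) (Nat.mod w 2) (node (addL d l (Nat.div w 2) c) r)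
            (fun _ => node l (addL d r (Nat.div w 2) c))) := fun _ _ => rfl
    rw [step nil nil, add, show Nat.div w 2 = w / 2 from rfl]
    cases t with
    | nil =>
      show @Nat.casesOn (fun _ => Trie) (Nat.mod w 2) _ _ = _
      rw [natCasesOn_mod_two, addL_eq d nil]; rfl
    | leaf z =>
      show @Nat.casesOn (fun _ => Trie) (Nat.mod w 2) _ _ = _
      rw [natCasesOn_mod_two, addL_eq d nil]; rfl
    | node l r =>
      show @Nat.casesOn (fun _ => Trie) (Nat.mod w 2) _ _ = _
      rw [natCasesOn_mod_two, addL_eq d l, addL_eq d r]; rfl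

end Trie

/-! ## Sortedness of the stored entries (family level) -/

/-- Keys of a combination are `≥ b` and strictly increasing (raw `List.rec`). [folklore] -/
def sortedFrom : List (ℕ × ℤ) → ℕ → Bool :=
  @List.rec (ℕ × ℤ) (fun _ => ℕ → Bool) (fun _ => true) (fun p _ ih b => Nat.ble b p.1 && ih (Nat.add p.1 1))

/-- Unfolding `sortedFrom` on a `cons`. [folklore] -/
theorem sortedFrom_cons (w : ℕ) (c : ℤ) (L : List (ℕ × ℤ)) (b : ℕ) :
    sortedFrom ((w, c) :: L) b = (Nat.ble b w && sortedFrom L (w + 1)) := rfl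

/-- A combination sorted from `b' ≥ b` is sorted from `b`. [folklore] -/
theorem sortedFrom_mono : ∀ (L : List (ℕ × ℤ)) {b b' : ℕ}, b ≤ b' → sortedFrom L b' = true → sortedFrom L b = true
  | [], _, _, _, _ => rfl
  | (w, c) :: L, b, b', hbb, h => by
    rw [sortedFrom_cons, Bool.and_eq_true, Nat.ble_eq] at h ⊢
    exact ⟨le_trans hbb h.1, h.2⟩

/-- **Family-level check**: every stored combination, in every row of every block, has strictly increasing keys.
[folklore] -/
def sortedCheck (EB : List (List (List (List (ℕ × ℤ))))) : Bool :=
  EB.all fun blk => blk.all fun row => row.all fun e => sortedFrom e 0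

/-- `getD` preserves an `all`-property when the default has it. [folklore] -/
private theorem all_getD {α : Type _} {p : α → Bool} :
    ∀ (L : List α) (k : ℕ) {dflt : α}, p dflt = true → L.all p = true → p (L.getD k dflt) = true
  | [], _, _, hd, _ => by simpa using hd
  | a :: L, 0, _, _, h => by simp only [List.all_cons, Bool.and_eq_true] at h; simpa using h.1
  | a :: L, k + 1, _, hd, h => by
    simp only [List.all_cons, Bool.and_eq_true] at h
    simpa using all_getD L k hd h.2

/-- What `sortedCheck` gives for an arbitrary stored row (out-of-range indices hold `[]`). [folklore] -/
theorem sorted_of_check {EB : List (List (List (List (ℕ × ℤ))))} (h : sortedCheck EB = true) (k i : ℕ) :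
    ∀ e ∈ (EB.getD k []).getD i [], sortedFrom e 0 = true := by
  unfold sortedCheck at h
  have h1 := all_getD (p := fun blk : List (List (List (ℕ × ℤ))) => blk.all fun row => row.all fun e => sortedFrom e 0)
    EB k (dflt := []) (by simp) h
  have h2 := all_getD (p := fun row : List (List (ℕ × ℤ)) => row.all fun e => sortedFrom e 0)
    (EB.getD k []) i (dflt := []) (by simp) h1
  simpa [List.all_eq_true] using h2

/-! ## The shifted-and-filtered table (specification side) -/

/-- Keep the terms `lo ≤ v < hi` and shift their keys to `v − lo`. [folklore] -/
def shiftFilter (lo hi : ℕ) : List (ℕ × ℤ) → List (ℕ × ℤ)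
  | [] => []
  | (w, c) :: rest => if lo ≤ w ∧ w < hi then (w - lo, c) :: shiftFilter lo hi rest else shiftFilter lo hi rest

/-- A combination sorted from `b ≥ hi` has no window terms. [folklore] -/
theorem shiftFilter_eq_nil {lo hi : ℕ} : ∀ (L : List (ℕ × ℤ)) {b : ℕ}, sortedFrom L b = true → hi ≤ b →
    shiftFilter lo hi L = []
  | [], _, _, _ => rfl
  | (w, c) :: L, b, h, hb => by
    rw [sortedFrom_cons, Bool.and_eq_true, Nat.ble_eq] at h
    rw [shiftFilter, if_neg (by omega), shiftFilter_eq_nil L h.2 (by omega)]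

/-- Coefficients of the shifted table: `coef (shiftFilter lo hi L) v' = coef L (lo + v')` for `v' < hi − lo`.
[folklore] -/
theorem coef_shiftFilter (lo hi : ℕ) {v' : ℕ} (hv : v' < hi - lo) :
    ∀ L : List (ℕ × ℤ), coef (shiftFilter lo hi L) v' = coef L (lo + v')
  | [] => rfl
  | (w, c) :: L => by
    rw [shiftFilter]
    by_cases h : lo ≤ w ∧ w < hi
    · rw [if_pos h, coef, coef, coef_shiftFilter lo hi hv L]
      have hb : ((w - lo : ℕ) == v') = (w == lo + v') := by
        by_cases h' : w - lo = v'
        · rw [beq_iff_eq.mpr h', beq_iff_eq.mpr (by omega)]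
        · rw [beq_eq_false_iff_ne.mpr h', beq_eq_false_iff_ne.mpr (by omega)]
      rw [hb]
    · rw [if_neg h, coef, coef_shiftFilter lo hi hv L, beq_eq_false_iff_ne.mpr (by omega)]
      simp

/-- `getD` through `map` when the default is mapped to the default. [folklore] -/
private theorem getD_map_of {α β : Type _} (f : α → β) {d : α} {d' : β} (h : f d = d') :
    ∀ (l : List α) (n : ℕ), (l.map f).getD n d' = f (l.getD n d)
  | [], _ => by simp [h]
  | _ :: _, 0 => by simp
  | _ :: l, n + 1 => by simp only [List.map_cons, List.getD_cons_succ]; exact getD_map_of f h l n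

/-- A stored row with every combination shifted-and-filtered. [folklore] -/
def rowShift (lo hi : ℕ) (row : List (List (ℕ × ℤ))) : List (List (ℕ × ℤ)) := row.map (shiftFilter lo hi)

/-- A block with every stored row shifted. [folklore] -/
def blkShift (lo hi : ℕ) (blk : List (List (List (ℕ × ℤ)))) : List (List (List (ℕ × ℤ))) :=
  blk.map (rowShift lo hi)

/-- The table with every stored combination shifted-and-filtered. [folklore] -/
def EBshift (lo hi : ℕ) (EB : List (List (List (List (ℕ × ℤ))))) : List (List (List (List (ℕ × ℤ)))) :=
  EB.map (blkShift lo hi)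

/-- Rows of the shifted table. [folklore] -/
theorem getD_EBshift (lo hi : ℕ) (EB : List (List (List (List (ℕ × ℤ))))) (k i : ℕ) :
    ((EBshift lo hi EB).getD k []).getD i [] = (((EB.getD k []).getD i []).map (shiftFilter lo hi)) := by
  rw [EBshift, getD_map_of (blkShift lo hi) (show blkShift lo hi [] = [] from rfl), blkShift,
    getD_map_of (rowShift lo hi) (show rowShift lo hi [] = [] from rfl), rowShift]

/-- Entries of the shifted table. [folklore] -/
theorem ent_EBshift (lo hi : ℕ) (EB : List (List (List (List (ℕ × ℤ))))) (k i j : ℕ) :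
    ent (EBshift lo hi EB) k i j = shiftFilter lo hi (ent EB k i j) := by
  have hU : ∀ a b : ℕ, entU (EBshift lo hi EB) k a b = shiftFilter lo hi (entU EB k a b) := fun a b => by
    rw [entU, entU, getD_EBshift, getD_map_of (shiftFilter lo hi) (show shiftFilter lo hi [] = [] from rfl)]
  unfold ent
  split_ifs <;> exact hU _ _

/-- The row-length check is invariant under shifting. [folklore] -/
theorem rowLenCheck_EBshift (lo hi : ℕ) (EB : List (List (List (List (ℕ × ℤ))))) (m nb : ℕ) :
    rowLenCheck (EBshift lo hi EB) m nb = rowLenCheck EB m nb := by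
  unfold rowLenCheck
  congr 1; funext k; congr 1; funext i
  rw [getD_EBshift, List.length_map]

/-- **Trace values of the shifted table**: `trZ (EBshift lo hi EB) v' = trZ EB (lo + v')` for `v' < hi − lo`.
[folklore] -/
theorem trZ_shift (GB : List (List (List ℤ))) (EB : List (List (List (List (ℕ × ℤ))))) (nb m lo hi : ℕ)
    {v' : ℕ} (hv : v' < hi - lo) : trZ GB (EBshift lo hi EB) nb m v' = trZ GB EB nb m (lo + v') := by
  unfold trZ
  refine Finset.sum_congr rfl fun k _ => Finset.sum_congr rfl fun i _ => Finset.sum_congr rfl fun j _ => ?_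
  simp only [posTerm, ent_EBshift, coef_shiftFilter lo hi hv]

/-! ## Kernel-side early-exit sweep -/

/-- Early-exit shifted term walk (terms sorted by key): skip `v < lo`, add `c · wt` at key `v − lo` while `v < hi`,
stop at the first `v ≥ hi`. [folklore] -/
def accTermsE (d lo hi : ℕ) (wt : ℤ) (L : List (ℕ × ℤ)) : Trie → Trie :=
  @List.rec (ℕ × ℤ) (fun _ => Trie → Trie) (fun t => t)
    (fun p _ ih t => bif Nat.blt p.1 hi then
        (bif Nat.ble lo p.1 then ih (Trie.addL d t (Nat.sub p.1 lo) (Int.mul p.2 wt)) else ih t)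
      else t) L

/-- Unfolding `accTermsE` on a `cons`. [folklore] -/
theorem accTermsE_cons (d lo hi : ℕ) (wt : ℤ) (w : ℕ) (c : ℤ) (L : List (ℕ × ℤ)) (t : Trie) :
    accTermsE d lo hi wt ((w, c) :: L) t =
      (bif Nat.blt w hi then
        (bif Nat.ble lo w then accTermsE d lo hi wt L (Trie.addL d t (w - lo) (Int.mul c wt)) else accTermsE d lo hi wt L t)
      else t) := rfl

/-- `accTermsE` is the part-5 walk of the shifted-and-filtered combination over the window `0 ≤ v' < hi − lo`.
[folklore] -/
theorem accTermsE_eq (d lo hi : ℕ) (wt : ℤ) : ∀ (L : List (ℕ × ℤ)) (b : ℕ) (t : Trie), sortedFrom L b = true →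
    accTermsE d lo hi wt L t = accTermsR d 0 (hi - lo) wt (shiftFilter lo hi L) t
  | [], _, _, _ => rfl
  | (w, c) :: L, b, t, hs => by
    rw [sortedFrom_cons, Bool.and_eq_true] at hs
    rw [accTermsE_cons, shiftFilter]
    by_cases hw : w < hi
    · rw [Nat.blt_eq.mpr hw, cond_true]
      by_cases hl : lo ≤ w
      · rw [Nat.ble_eq.mpr hl, cond_true, if_pos ⟨hl, hw⟩, accTermsR_cons,
          show (Nat.ble 0 (w - lo) && Nat.blt (w - lo) (hi - lo)) = true by
            rw [Bool.and_eq_true, Nat.ble_eq, Nat.blt_eq]; omega,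
          cond_true, Trie.addL_eq, Trie.addR_eq, accTermsE_eq d lo hi wt L (w + 1) _ hs.2]
      · have hb : Nat.ble lo w = false := by rw [Bool.eq_false_iff, ne_eq, Nat.ble_eq]; exact hl
        rw [hb, cond_false, if_neg (fun h => hl h.1), accTermsE_eq d lo hi wt L (w + 1) _ hs.2]
    · have hb : Nat.blt w hi = false := by rw [Bool.eq_false_iff, ne_eq, Nat.blt_eq]; exact hw
      rw [hb, cond_false, if_neg (fun h => hw h.2), shiftFilter_eq_nil L hs.2 (by omega)]
      rfl

/-- Row walk: stored entries of a row in lockstep with the factor rows, raw dot product, early-exit term walk.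
[folklore] -/
def accRowE (d lo hi : ℕ) (Gi : List ℤ) (es : List (List (ℕ × ℤ))) : Bool → List (List ℤ) → Trie → Trie :=
  @List.rec (List (ℕ × ℤ)) (fun _ => Bool → List (List ℤ) → Trie → Trie) (fun _ _ t => t)
    (fun e _ ih first Gs t =>
      ih false Gs.tail (accTermsE d lo hi (Int.mul (bif first then 1 else 2) (listDotR Gi (Gs.headD []))) e t)) es

/-- Unfolding `accRowE` on a `cons`. [folklore] -/
theorem accRowE_cons (d lo hi : ℕ) (Gi : List ℤ) (e : List (ℕ × ℤ)) (es : List (List (ℕ × ℤ))) (first : Bool)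
    (Gs : List (List ℤ)) (t : Trie) : accRowE d lo hi Gi (e :: es) first Gs t =
      accRowE d lo hi Gi es false Gs.tail
        (accTermsE d lo hi (Int.mul (bif first then 1 else 2) (listDotR Gi (Gs.headD []))) e t) := rfl

/-- `accRowE` is the part-5 row walk of the shifted row. [folklore] -/
theorem accRowE_eq (d lo hi : ℕ) (Gi : List ℤ) : ∀ (es : List (List (ℕ × ℤ))) (first : Bool) (Gs : List (List ℤ))
    (t : Trie), (∀ e ∈ es, sortedFrom e 0 = true) →
    accRowE d lo hi Gi es first Gs t = accRowR d 0 (hi - lo) Gi (es.map (shiftFilter lo hi)) first Gs t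
  | [], _, _, _, _ => rfl
  | e :: es, first, Gs, t, hs => by
    rw [accRowE_cons, List.map_cons, accRowR_cons, listDotR_eq,
      accTermsE_eq d lo hi _ e 0 t (hs e (by simp)),
      accRowE_eq d lo hi Gi es false Gs.tail _ fun e' he' => hs e' (by simp [he'])]

/-- Row loop of block `k` (raw `Nat.rec`). [folklore] -/
def accIE (GB : List (List (List ℤ))) (EB : List (List (List (List (ℕ × ℤ))))) (d lo hi k : ℕ) (n : ℕ) :
    Trie → Trie :=
  @Nat.rec (fun _ => Trie → Trie) (fun t => t)
    (fun i ih t => ih (accRowE d lo hi (grow GB k i) ((EB.getD k []).getD i []) true ((GB.getD k []).drop i) t)) n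

/-- Unfolding `accIE`. [folklore] -/
theorem accIE_succ (GB : List (List (List ℤ))) (EB : List (List (List (List (ℕ × ℤ))))) (d lo hi k i : ℕ)
    (t : Trie) : accIE GB EB d lo hi k (i + 1) t =
      accIE GB EB d lo hi k i (accRowE d lo hi (grow GB k i) ((EB.getD k []).getD i []) true ((GB.getD k []).drop i) t) :=
  rfl

/-- `accIE` is the part-5 row loop on the shifted table. [folklore] -/
theorem accIE_eq (GB : List (List (List ℤ))) {EB : List (List (List (List (ℕ × ℤ))))} (hs : sortedCheck EB = true)
    (d lo hi k : ℕ) : ∀ (n : ℕ) (t : Trie),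
    accIE GB EB d lo hi k n t = accIR GB (EBshift lo hi EB) d 0 (hi - lo) k n t
  | 0, _ => rfl
  | i + 1, t => by
    rw [accIE_succ, accIR_succ, getD_EBshift, accRowE_eq d lo hi _ _ _ _ _ (sorted_of_check hs k i),
      accIE_eq GB hs d lo hi k i]

/-- Block loop (raw `Nat.rec`). [folklore] -/
def accKE (GB : List (List (List ℤ))) (EB : List (List (List (List (ℕ × ℤ))))) (d lo hi m : ℕ) (n : ℕ) :
    Trie → Trie :=
  @Nat.rec (fun _ => Trie → Trie) (fun t => t) (fun k ih t => ih (accIE GB EB d lo hi k m t)) n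

/-- Unfolding `accKE`. [folklore] -/
theorem accKE_succ (GB : List (List (List ℤ))) (EB : List (List (List (List (ℕ × ℤ))))) (d lo hi m k : ℕ)
    (t : Trie) : accKE GB EB d lo hi m (k + 1) t = accKE GB EB d lo hi m k (accIE GB EB d lo hi k m t) := rfl

/-- `accKE` is the part-5 block loop on the shifted table. [folklore] -/
theorem accKE_eq (GB : List (List (List ℤ))) {EB : List (List (List (List (ℕ × ℤ))))} (hs : sortedCheck EB = true)
    (d lo hi m : ℕ) : ∀ (n : ℕ) (t : Trie),
    accKE GB EB d lo hi m n t = accKR GB (EBshift lo hi EB) d 0 (hi - lo) m n t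
  | 0, _ => rfl
  | k + 1, t => by rw [accKE_succ, accKR_succ, accIE_eq GB hs, accKE_eq GB hs d lo hi m k]

/-- **The early-exit shifted sweep** (kernel side). [folklore] -/
def sweepE (GB : List (List (List ℤ))) (EB : List (List (List (List (ℕ × ℤ))))) (nb m d lo hi : ℕ) : Trie :=
  accKE GB EB d lo hi m nb Trie.nil

/-- `sweepE` is the part-5 sweep of the shifted table over the window `0 ≤ v' < hi − lo`. [folklore] -/
theorem sweepE_eq (GB : List (List (List ℤ))) {EB : List (List (List (List (ℕ × ℤ))))} (hs : sortedCheck EB = true)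
    (nb m d lo hi : ℕ) : sweepE GB EB nb m d lo hi = sweepR GB (EBshift lo hi EB) nb m d 0 (hi - lo) :=
  accKE_eq GB hs d lo hi m nb Trie.nil

/-- **Sweep semantics**: for `v' < hi − lo ≤ 2^d` the accumulator of key `v'` is `trZ EB (lo + v')`. [folklore] -/
theorem getR_sweepE {GB : List (List (List ℤ))} {EB : List (List (List (List (ℕ × ℤ))))} {nb m d lo hi : ℕ}
    (hs : sortedCheck EB = true) (hrow : rowLenCheck EB m nb = true) (hd : hi - lo ≤ 2 ^ d) {v' : ℕ}
    (hv : v' < hi - lo) : (sweepE GB EB nb m d lo hi).getR d v' = trZ GB EB nb m (lo + v') := by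
  rw [sweepE_eq GB hs, getR_sweepR (by rw [rowLenCheck_EBshift]; exact hrow) hd (Nat.zero_le _) hv,
    trZ_shift GB EB nb m lo hi hv]

/-! ## Window check, early-exit form -/

/-- Residual walk with shifted trie keys (`v − lo`); the accumulator is forced after every step. [folklore] -/
def resWalkE (d lo : ℕ) (tr : Trie) (cZ : List (ℕ × ℤ)) (P D : ℤ) (n : ℕ) : List ℤ → ℕ → ℤ → ℤ :=
  @Nat.rec (fun _ => List ℤ → ℕ → ℤ → ℤ) (fun _ _ acc => acc)
    (fun _ ih ns v acc =>
      @Int.casesOn (fun _ => ℤ) (Int.add acc (gZ P D v (coef cZ v) (ns.headD 0) (Trie.getR d tr (Nat.sub v lo))))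
        (fun _ => ih ns.tail (v + 1) (Int.add acc (gZ P D v (coef cZ v) (ns.headD 0) (Trie.getR d tr (Nat.sub v lo)))))
        (fun _ => ih ns.tail (v + 1) (Int.add acc (gZ P D v (coef cZ v) (ns.headD 0) (Trie.getR d tr (Nat.sub v lo))))))
    n

/-- Unfolding `resWalkE` one step. [folklore] -/
theorem resWalkE_succ (d lo : ℕ) (tr : Trie) (cZ : List (ℕ × ℤ)) (P D : ℤ) (n : ℕ) (ns : List ℤ) (v : ℕ)
    (acc : ℤ) : resWalkE d lo tr cZ P D (n + 1) ns v acc =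
      resWalkE d lo tr cZ P D n ns.tail (v + 1)
        (acc + gZ P D v (coef cZ v) (ns.headD 0) (Trie.getR d tr (v - lo))) := by
  have key : ∀ (A E : ℤ), @Int.casesOn (fun _ => ℤ) A (fun _ => E) (fun _ => E) = E := fun A E => by
    cases A <;> rfl
  exact key _ _

/-- `(l.drop v).headD 0 = l[v]` (default `0`). [folklore] -/
private theorem headD_drop' : ∀ (l : List ℤ) (v : ℕ), (l.drop v).headD 0 = l.getD v 0
  | [], v => by simp
  | a :: l, 0 => by simp
  | a :: l, v + 1 => by rw [List.drop_succ_cons, headD_drop' l v, List.getD_cons_succ]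

/-- Semantics of `resWalkE`. [folklore] -/
theorem resWalkE_eq (d lo : ℕ) (tr : Trie) (cZ : List (ℕ × ℤ)) (P D : ℤ) (RN : List ℤ) :
    ∀ (n v : ℕ) (acc : ℤ), resWalkE d lo tr cZ P D n (RN.drop v) v acc =
      acc + ∑ i ∈ Finset.range n,
        gZ P D (v + i) (coef cZ (v + i)) (RN.getD (v + i) 0) (Trie.getR d tr (v + i - lo))
  | 0, v, acc => by simp [resWalkE]
  | n + 1, v, acc => by
    rw [resWalkE_succ, List.tail_drop, headD_drop', resWalkE_eq d lo tr cZ P D RN n (v + 1), Finset.sum_range_succ',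
      add_assoc, add_comm (∑ i ∈ Finset.range n, _)]
    simp only [Nat.add_zero, Nat.add_right_comm v 1, Nat.add_assoc]

/-- **Window check (early-exit form)**: `lo ≤ hi`, `hi − lo ≤ 2^d`, sweep, residual walk, comparison with the
emitted integer `s`. [folklore] -/
def winCheckE (GB : List (List (List ℤ))) (EB : List (List (List (List (ℕ × ℤ))))) (nb m d : ℕ)
    (cZ : List (ℕ × ℤ)) (RN : List ℤ) (P D : ℤ) (lo hi : ℕ) (s : ℤ) : Bool :=
  decide (lo ≤ hi) && decide (hi - lo ≤ 2 ^ d) &&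
    decide (resWalkE d lo (sweepE GB EB nb m d lo hi) cZ P D (hi - lo) (RN.drop lo) lo 0 = s)

/-- **Soundness of `winCheckE`** (under the family's sortedness and row-length checks): the SAME window statement
`WinOK` as part 5b. [folklore] -/
theorem winOK_of_checkE {GB : List (List (List ℤ))} {EB : List (List (List (List (ℕ × ℤ))))} {nb m d : ℕ}
    {cZ : List (ℕ × ℤ)} {RN : List ℤ} {P D : ℤ} {lo hi : ℕ} {s : ℤ} (hsort : sortedCheck EB = true)
    (hrow : rowLenCheck EB m nb = true) (h : winCheckE GB EB nb m d cZ RN P D lo hi s = true) :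
    WinOK GB EB nb m cZ RN P D lo hi s := by
  rw [winCheckE, Bool.and_eq_true, Bool.and_eq_true, decide_eq_true_eq, decide_eq_true_eq, decide_eq_true_eq] at h
  obtain ⟨⟨hlh, hd⟩, hs⟩ := h
  refine ⟨hlh, ?_⟩
  rw [← hs, resWalkE_eq, zero_add]
  refine Finset.sum_congr rfl fun i hi' => ?_
  rw [Finset.mem_range] at hi'
  rw [show lo + i - lo = i by omega, getR_sweepE hsort hrow hd hi', gZ_eq]

end

end Summit.QuantumFields.GaugeBoot.Certificates.Sparse
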